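import Summits.BirchSwinnertonDyer.Rank1Residual.GaloisImage.InertiaRootableNonsplitMultiplicative
import Literature.NumberTheory.EllipticCurves.Fisher2016.CongruentKummerConditions
import Literature.NumberTheory.EllipticCurves.SelmerLocalConditionGoodReductionProofs
import Literature.NumberTheory.EllipticCurves.KummerSelmerStructure
import HarnessLib

/-!
# `𝓢_v(E) = ker (H¹(K, E[n]) → H¹(I_{𝔓₀}, E[n]))` whenever `𝓛_v(E[n]) = H¹_ur(K_v, E[n])`, and
# FISHER 2016 Thm. 4.4 AT `v ∤ p` AS A THEOREM: the local Selmer conditions of `p`-congruent curves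
# agree at a place where one is NON-SPLIT multiplicative and the other GOOD (team n1011, seat p10 GEN 14)

HONEST FRAMING (cell `b2b-bsdres-*`, team n1011, verbatim): prove what is provable now; shrink each
hard class to its core with data; no claim beyond stated classes. Research route; TOOL theorems
only — no definition, no named fact, nothing booked, no residual-map mark moved, no class closed.
This file does NOT discharge the registered fact `Fisher2016.thm44_selmerLocalKer_iff_of_nonsplit_good`
(A46): its `v ∣ p`, `e(v|p) < p − 1` disjunct (Fisher's Lemma 4.3, formal groups + Schaefer's
cokernel formula + Tate local duality) is out of reach; the `v ∤ p` disjunct IS proved here,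
hypothesis-free, in the fact's own binder shape (`…_of_not_mem`).  Compare the cell's kind (iv′)/(vi)
theorems of `NonsplitMultiplicativeUnramifiedSelmer` / `NonsplitMultiplicativeKummerTransport`
(seat p04), which are CONDITIONAL on Tate's uniformisation `Silverman1994_thmV53_corV54_tateUniformisation`
(`hU2`) and phrase "non-split" as "`−c₄/c₆` a non-square in `K_v`": here NO named fact, and Mathlib's
`¬ HasSplitMultiplicativeReductionAt` (the node-tangent polynomial does not split over `k_v`).  Not a re-key of any
record (consumers' lineages), closes no row, no §K.2 letter (cell row T-ROOT, lead R5-132).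

## What

* `selmerLocalKer_eq_unramifiedKer_of_kummerLocalConditionAt_eq` — BRIDGE between the two Selmer
  currencies of the tree: if the local Kummer condition `𝓛_v(E[n]) ≤ H¹(K_v, E[n])`
  (`kummerLocalConditionAt`) equals `H¹_ur(K_v, E[n])` (`unramifiedSubgroup … 1`), then the global
  local-kernel `𝓢_v(E) = selmerLocalKer W K_v n = res_v⁻¹ 𝓛_v` (`comap_res_kummerLocalConditionAt`)
  is `unramifiedKer (E[n]) 𝔓₀`, the classes principal on the inertia group `I_{𝔓₀} = res (I_{K_v})`
  of the chosen prime `𝔓₀ = adicCompletionPrime K v` (cocycle criteria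
  `LocBridge.mem_unramifiedSubgroup_one_iff_exists`, `oneCocycleClass_mem_subgroupResKer_iff`);
* `selmerLocalKer_eq_unramifiedKer_of_nonsplit` — hence `𝓢_v(E) = unramifiedKer (E[p]) 𝔓₀` at a
  NON-SPLIT multiplicative `v ∤ p`, `p` odd (sibling file: `𝓛_v = H¹_ur` there), the bad-reduction
  companion of the tree's `selmerLocalKer_eq_unramifiedKer` (good `v ∤ n`, Gross 1991 (7.1));
* **`selmerLocalKer_iff_h1Equiv_of_nonsplit_good_of_not_mem`** — FISHER 2016 THM. 4.4 AT `v ∤ p`: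
  for a `Γ_K`-isomorphism `θ : E′[p] ⥲ E[p]`, `p` odd, and a place `v ∤ p` where one curve is
  non-split multiplicative and the other good, `c ∈ 𝓢_v(E′) ↔ θ_* c ∈ 𝓢_v(E)` (both sides are
  "unramified at `𝔓₀`", which passes through `θ`, `mem_unramifiedKer_iff_h1Equiv_mem`); with the
  one-sided forms `h1Equiv_mem_selmerLocalKer_of_not_split_of_good` / `…_of_good_of_not_split` and
  the comparison index `ι_v(θ) = 1` (`relIndex_map_selmerLocalKer_eq_one_…`).

References: [Fisher2016Visualizing7] Thm. 4.4 (p. 106); [GrossLMS1991] §7 (7.1); [MilneADT2006]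
I §2, Prop. I.3.8; [CremonaMazur2000] §3; [SilvermanAEC2009] X.§4.
-/

noncomputable section

open scoped Classical Pointwise

open NumberField IsDedekindDomain Field WeierstrassCurve
open Literature.NumberTheory.EllipticCurves Literature.NumberTheory.EllipticCurves.GreenbergSelmer
open Literature.NumberTheory.GaloisRepresentations
open Literature.NumberTheory.GaloisRepresentations.IsNonarchimedeanLocalField
open Literature.NumberTheory.GaloisRepresentations.DiscreteGaloisModule (unramifiedSubgroup)

namespace Summit.BirchSwinnertonDyer.Rank1Residual.GaloisImage.InertiaDivisible

open Summit.BirchSwinnertonDyer.Rank1Residual.X11b.LocBridge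

variable {K : Type} [Field K] [NumberField K] (W : WeierstrassCurve K) [W.IsElliptic]

/-! ## §1. The bridge `𝓢_v = res_v⁻¹ 𝓛_v` + `𝓛_v = H¹_ur` ⟹ `𝓢_v = unramifiedKer 𝔓₀` -/

omit [W.IsElliptic] in
/-- **`𝓢_v(E) = unramifiedKer (E[n]) 𝔓₀` whenever `𝓛_v(E[n]) = H¹_ur(K_v, E[n])`.**  The global
local-kernel `selmerLocalKer W K_v n` is `res_v⁻¹ 𝓛_v` (`comap_res_kummerLocalConditionAt`); if
`𝓛_v = unramifiedSubgroup (E[n]|_{Γ_{K_v}}) 1`, a class `[φ]` lies in it iff `φ ∘ res` is principal on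
the local inertia group `absInertia K_v` (`LocBridge.mem_unramifiedSubgroup_one_iff_exists`), iff `φ`
is principal on `I_{𝔓₀} = res (absInertia K_v)` (`inertia_adicCompletionPrime_eq_map_absInertia`), iff
`[φ] ∈ unramifiedKer (E[n]) 𝔓₀` (`oneCocycleClass_mem_subgroupResKer_iff`).
[cite: MilneADT2006, Ch. I §2 (unramified cohomology)] [cite: SilvermanAEC2009, VIII.§2 Definition p. 191] -/
theorem selmerLocalKer_eq_unramifiedKer_of_kummerLocalConditionAt_eq {n : ℤ}
    {v : HeightOneSpectrum (𝓞 K)}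
    (hL : W.kummerLocalConditionAt n (v.adicCompletion K) =
      unramifiedSubgroup (GaloisRep.restrictField (v.adicCompletion K) (W.torsionGaloisModule n)) 1) :
    selmerLocalKer W (v.adicCompletion K) n =
      unramifiedKer (geomTorsion W n) (adicCompletionPrime K v) := by
  ext c
  obtain ⟨φ, rfl⟩ :=
    oneCocycleClass_surjective (discreteTopRep (absoluteGaloisGroup K) (geomTorsion W n)) c
  rw [← comap_res_kummerLocalConditionAt]
  change galoisCohomology.res (W.torsionGaloisModule n) (v.adicCompletion K) 1
      (oneCocycleClass (discreteTopRep (absoluteGaloisGroup K) (geomTorsion W n)) φ) ∈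
      W.kummerLocalConditionAt n (v.adicCompletion K) ↔ _
  rw [hL, res_torsionGaloisModule_oneCocycleClass]
  refine (mem_unramifiedSubgroup_one_iff_exists _ _).trans ?_
  rw [unramifiedKer, oneCocycleClass_mem_subgroupResKer_iff]
  constructor
  · rintro ⟨w, hw⟩
    refine ⟨w, fun σ ↦ ?_⟩
    have hσ : (σ : absoluteGaloisGroup K) ∈
        (absInertia (v.adicCompletion K)).map (absGaloisRestrict K (v.adicCompletion K)).toMonoidHom := by
      rw [← inertia_adicCompletionPrime_eq_map_absInertia]; exact σ.2
    obtain ⟨τ, hτ, hτσ⟩ := Subgroup.mem_map.mp hσ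
    have h := hw τ hτ
    rw [contOneCocycles.pullback_apply] at h
    change φ.1 (absGaloisRestrict K (v.adicCompletion K) τ) =
      absGaloisRestrict K (v.adicCompletion K) τ • w - w at h
    have hτσ' : absGaloisRestrict K (v.adicCompletion K) τ = (σ : absoluteGaloisGroup K) := hτσ
    rw [hτσ'] at h
    exact h
  · rintro ⟨a, ha⟩
    refine ⟨a, fun τ hτ ↦ ?_⟩
    have hmem : absGaloisRestrict K (v.adicCompletion K) τ ∈
        (adicCompletionPrime K v).inertia (absoluteGaloisGroup K) := by
      rw [inertia_adicCompletionPrime_eq_map_absInertia]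
      exact Subgroup.mem_map.mpr ⟨τ, hτ, rfl⟩
    have h := ha ⟨_, hmem⟩
    rw [contOneCocycles.pullback_apply]
    change φ.1 (absGaloisRestrict K (v.adicCompletion K) τ) =
      absGaloisRestrict K (v.adicCompletion K) τ • a - a
    exact h

/-- **`𝓢_v(E) = unramifiedKer (E[p^k]) 𝔓₀` at a finite `v ∤ p` under (ROOT)** (sibling files:
`𝓛_v(E[p^k]) = H¹_ur(K_v, E[p^k])` there). [cite: MilneADT2006, Ch. I Prop. 3.8] [cite: GrossLMS1991, §7 (7.1)] -/
theorem selmerLocalKer_eq_unramifiedKer_of_rootable (p k : ℕ) [Fact p.Prime]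
    {v : HeightOneSpectrum (𝓞 K)} (hpv : (p : 𝓞 K) ∉ v.asIdeal)
    (hroot : ∀ t : W.geomPrimaryTorsion p,
      (∀ σ : absoluteGaloisGroup (v.adicCompletion K),
        absGaloisRestrict K (v.adicCompletion K) σ • t = t) →
      ∀ k : ℕ, ∃ s : W.geomPrimaryTorsion p,
        (∀ τ ∈ absInertia (v.adicCompletion K), absGaloisRestrict K (v.adicCompletion K) τ • s = s) ∧
          p ^ k • s = t) :
    selmerLocalKer W (v.adicCompletion K) ((p ^ k : ℕ) : ℤ) =
      unramifiedKer (geomTorsion W ((p ^ k : ℕ) : ℤ)) (adicCompletionPrime K v) :=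
  selmerLocalKer_eq_unramifiedKer_of_kummerLocalConditionAt_eq W
    (kummerLocalConditionAt_eq_unramifiedSubgroup_of_rootable W p k hpv hroot)

/-- **`𝓢_v(E) = unramifiedKer (E[p]) 𝔓₀` at a NON-SPLIT multiplicative `v ∤ p`, `p` odd** — the
bad-reduction companion of the tree's `selmerLocalKer_eq_unramifiedKer` (good `v ∤ n`, Gross 1991
(7.1) / Milne I.3.8): at such a place the local Selmer condition of `E[p]` IS "unramified at `v`",
with no hypothesis on `ord_v Δ`, `c_v`, `E(K_v)[p]` and no named fact.
[cite: MilneADT2006, Ch. I Prop. 3.8] [cite: Fisher2016Visualizing7, Thm. 4.4 (p. 106)] -/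
theorem selmerLocalKer_eq_unramifiedKer_of_nonsplit (p : ℕ) [Fact p.Prime]
    {v : HeightOneSpectrum (𝓞 K)} (hpv : (p : 𝓞 K) ∉ v.asIdeal) (hp2 : p ≠ 2)
    (hmult : W.HasMultiplicativeReductionAt v) (hns : ¬ W.HasSplitMultiplicativeReductionAt v) :
    selmerLocalKer W (v.adicCompletion K) (p : ℤ) =
      unramifiedKer (geomTorsion W (p : ℤ)) (adicCompletionPrime K v) :=
  selmerLocalKer_eq_unramifiedKer_of_kummerLocalConditionAt_eq W
    (kummerLocalConditionAt_eq_unramifiedSubgroup_of_nonsplit_prime W p hpv hp2 hmult hns)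

/-- Level `p^k`: `𝓢_v(E) = unramifiedKer (E[p^k]) 𝔓₀` at a NON-SPLIT multiplicative `v ∤ p`, `p` odd.
[cite: MilneADT2006, Ch. I Prop. 3.8] -/
theorem selmerLocalKer_eq_unramifiedKer_of_nonsplit_pow (p k : ℕ) [Fact p.Prime]
    {v : HeightOneSpectrum (𝓞 K)} (hpv : (p : 𝓞 K) ∉ v.asIdeal) (hp2 : p ≠ 2)
    (hmult : W.HasMultiplicativeReductionAt v) (hns : ¬ W.HasSplitMultiplicativeReductionAt v) :
    selmerLocalKer W (v.adicCompletion K) ((p ^ k : ℕ) : ℤ) =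
      unramifiedKer (geomTorsion W ((p ^ k : ℕ) : ℤ)) (adicCompletionPrime K v) :=
  selmerLocalKer_eq_unramifiedKer_of_kummerLocalConditionAt_eq W
    (kummerLocalConditionAt_eq_unramifiedSubgroup_of_nonsplit W p hpv hp2 hmult hns k)

/-! ## §1b. Conjugate primes: `unramifiedKer M (g • 𝔓) = unramifiedKer M 𝔓`, hence every `𝔓 ∣ v` -/

section Conjugate

omit [NumberField K] [W.IsElliptic]

set_option synthInstance.maxHeartbeats 200000 in
/-- `I_{g𝔓} = g I_𝔓 g⁻¹`: if `σ` lies in the inertia group of `g • 𝔓` then `g⁻¹ σ g` lies in the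
inertia group of `𝔓`. [cite: NeukirchANT1999, Ch. I §9 Prop. (9.4)–(9.6)] -/
theorem inv_mul_mul_mem_inertia_of_mem_inertia_smul {g σ : absoluteGaloisGroup K}
    {𝔓 : Ideal (absIntegers (𝓞 K) K)} (hσ : σ ∈ (g • 𝔓).inertia (absoluteGaloisGroup K)) :
    g⁻¹ * σ * g ∈ 𝔓.inertia (absoluteGaloisGroup K) := by
  rw [AddSubgroup.mem_inertia] at hσ ⊢
  intro x
  have h : g⁻¹ • (σ • (g • x) - g • x) ∈ g⁻¹ • (g • 𝔓) :=
    Ideal.smul_mem_pointwise_smul g⁻¹ _ (g • 𝔓) (hσ (g • x))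
  rw [inv_smul_smul] at h
  have e : (g⁻¹ * σ * g) • x - x = g⁻¹ • (σ • (g • x) - g • x) := by
    rw [smul_sub, mul_smul, mul_smul, inv_smul_smul]
  rw [Submodule.mem_toAddSubgroup, e]
  exact h

set_option synthInstance.maxHeartbeats 200000 in
/-- `σ ∈ I_{g𝔓} ↔ g⁻¹ σ g ∈ I_𝔓`. [cite: NeukirchANT1999, Ch. I §9 Prop. (9.4)–(9.6)] -/
theorem mem_inertia_smul_iff {g σ : absoluteGaloisGroup K} {𝔓 : Ideal (absIntegers (𝓞 K) K)} :
    σ ∈ (g • 𝔓).inertia (absoluteGaloisGroup K) ↔ g⁻¹ * σ * g ∈ 𝔓.inertia (absoluteGaloisGroup K) := by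
  refine ⟨inv_mul_mul_mem_inertia_of_mem_inertia_smul, fun h ↦ ?_⟩
  have h' := inv_mul_mul_mem_inertia_of_mem_inertia_smul (g := g⁻¹) (𝔓 := g • 𝔓)
    (σ := g⁻¹ * σ * g) (by rwa [inv_smul_smul])
  have e : g⁻¹⁻¹ * (g⁻¹ * σ * g) * g⁻¹ = σ := by group
  rwa [e] at h'

variable {M : Type} [AddCommGroup M] [DistribMulAction (absoluteGaloisGroup K) M]
  [TopologicalSpace M] [DiscreteTopology M]

/-- **`unramifiedKer` does not see which conjugate prime is chosen**: a class principal on `I_𝔓`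
(`φ σ = σ a − a` there) is principal on `I_{g𝔓} = g I_𝔓 g⁻¹`, with `a' = g a − φ g` (cocycle
identity). Silverman, *AEC* VIII.§2, remark after the Definition (p. 191). [cite: SilvermanAEC2009, Remark X.4.1.1] -/
theorem mem_unramifiedKer_smul (g : absoluteGaloisGroup K) (𝔓 : Ideal (absIntegers (𝓞 K) K))
    {c : discreteH1 (absoluteGaloisGroup K) M} (hc : c ∈ unramifiedKer M 𝔓) :
    c ∈ unramifiedKer M (g • 𝔓) := by
  obtain ⟨φ, rfl⟩ := oneCocycleClass_surjective (discreteTopRep (absoluteGaloisGroup K) M) c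
  rw [unramifiedKer, oneCocycleClass_mem_subgroupResKer_iff] at hc ⊢
  obtain ⟨a, ha⟩ := hc
  have hmul : ∀ x y : absoluteGaloisGroup K, φ.1 (x * y) = φ.1 x + x • φ.1 y := fun x y ↦ by
    rw [φ.2 x y, discreteTopRep_ρ_apply]
  have h1 : φ.1 1 = 0 := contOneCocycles.apply_one φ
  have hinv : g • φ.1 g⁻¹ = -φ.1 g := by
    have h := hmul g g⁻¹
    rw [mul_inv_cancel, h1] at h
    exact eq_neg_of_add_eq_zero_right h.symm
  refine ⟨g • a - φ.1 g, fun σ ↦ ?_⟩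
  have hτ : g⁻¹ * (σ : absoluteGaloisGroup K) * g ∈ 𝔓.inertia (absoluteGaloisGroup K) :=
    inv_mul_mul_mem_inertia_of_mem_inertia_smul σ.2
  have key := ha ⟨_, hτ⟩
  have eσ : (σ : absoluteGaloisGroup K) = g * (g⁻¹ * σ * g) * g⁻¹ := by group
  have eτ : g * (g⁻¹ * (σ : absoluteGaloisGroup K) * g) = σ * g := by group
  have step : φ.1 σ = φ.1 g + g • φ.1 (g⁻¹ * σ * g) + ((σ : absoluteGaloisGroup K) * g) • φ.1 g⁻¹ := by
    conv_lhs => rw [eσ]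
    rw [hmul, hmul, eτ]
  rw [step, key, smul_sub, smul_smul, eτ, mul_smul, mul_smul, hinv, smul_neg, smul_sub]
  abel

set_option synthInstance.maxHeartbeats 200000 in
/-- `unramifiedKer M (g • 𝔓) = unramifiedKer M 𝔓`. [cite: SilvermanAEC2009, Remark X.4.1.1] -/
theorem unramifiedKer_smul (g : absoluteGaloisGroup K) (𝔓 : Ideal (absIntegers (𝓞 K) K)) :
    unramifiedKer M (g • 𝔓) = unramifiedKer M 𝔓 := by
  ext c
  refine ⟨fun h ↦ ?_, mem_unramifiedKer_smul g 𝔓⟩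
  have h' := mem_unramifiedKer_smul (M := M) g⁻¹ (g • 𝔓) h
  rwa [inv_smul_smul] at h'

end Conjugate

/-- **`𝓢_v(E) = unramifiedKer (E[p]) 𝔓` for EVERY prime `𝔓 ∣ v` at a NON-SPLIT multiplicative
`v ∤ p`, `p` odd** — the exact bad-reduction companion of the tree's
`selmerLocalKer_eq_unramifiedKer (hv : good) (hn) (h𝔓 : 𝔓 ∈ v.primesAbove)` (`Γ_K` is transitive on
the primes above `v`, `exists_smul_eq_of_mem_primesAbove_holds`; `unramifiedKer_smul`).
[cite: MilneADT2006, Ch. I Prop. 3.8] [cite: GrossLMS1991, §7 (7.1)] -/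
theorem selmerLocalKer_eq_unramifiedKer_of_nonsplit' (p : ℕ) [Fact p.Prime]
    {v : HeightOneSpectrum (𝓞 K)} (hpv : (p : 𝓞 K) ∉ v.asIdeal) (hp2 : p ≠ 2)
    (hmult : W.HasMultiplicativeReductionAt v) (hns : ¬ W.HasSplitMultiplicativeReductionAt v)
    {𝔓 : Ideal (absIntegers (𝓞 K) K)} (h𝔓 : 𝔓 ∈ v.primesAbove) :
    selmerLocalKer W (v.adicCompletion K) (p : ℤ) = unramifiedKer (geomTorsion W (p : ℤ)) 𝔓 := by
  obtain ⟨g, hg⟩ := HeightOneSpectrum.exists_smul_eq_of_mem_primesAbove_holds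
    (adicCompletionPrime_mem_primesAbove K v) h𝔓
  rw [← hg, unramifiedKer_smul]
  exact selmerLocalKer_eq_unramifiedKer_of_nonsplit W p hpv hp2 hmult hns

/-- At a NON-SPLIT multiplicative `v ∤ p`, `p` odd, "unramified at `𝔓`" does not depend on the
prime `𝔓 ∣ v` (both kernels are `𝓢_v(E)`; compare the tree's good-case `unramifiedKer_eq_of_mem_primesAbove`).
[cite: SilvermanAEC2009, Remark X.4.1.1] -/
theorem unramifiedKer_eq_of_mem_primesAbove_of_nonsplit (p : ℕ) [Fact p.Prime]
    {v : HeightOneSpectrum (𝓞 K)} (hpv : (p : 𝓞 K) ∉ v.asIdeal) (hp2 : p ≠ 2)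
    (hmult : W.HasMultiplicativeReductionAt v) (hns : ¬ W.HasSplitMultiplicativeReductionAt v)
    {𝔓 𝔓' : Ideal (absIntegers (𝓞 K) K)} (h𝔓 : 𝔓 ∈ v.primesAbove) (h𝔓' : 𝔓' ∈ v.primesAbove) :
    unramifiedKer (geomTorsion W (p : ℤ)) 𝔓 = unramifiedKer (geomTorsion W (p : ℤ)) 𝔓' := by
  rw [← selmerLocalKer_eq_unramifiedKer_of_nonsplit' W p hpv hp2 hmult hns h𝔓,
    selmerLocalKer_eq_unramifiedKer_of_nonsplit' W p hpv hp2 hmult hns h𝔓']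

/-! ## §2. Fisher 2016, Thm. 4.4 at `v ∤ p`, hypothesis-free -/

section Fisher

variable (W' : WeierstrassCurve K) [W'.IsElliptic] {p : ℕ} [hpr : Fact p.Prime]

/-- **Fisher, LMS J. Comput. Math. 19 (2016) Thm. 4.4, at a place `v ∤ p` — PROVED** (read on
restrictions of global classes, as the tree's fact `Fisher2016.thm44_selmerLocalKer_iff_of_nonsplit_good`
is typed): for a number field `K`, elliptic curves `E = W`, `E′ = W′`, an odd prime `p`, a
`Γ_K`-equivariant isomorphism `θ : E′[p] ⥲ E[p]` and a finite place `v ∤ p` at which one curve has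
NON-SPLIT multiplicative reduction and the other GOOD reduction, a class `c ∈ H¹(K, E′[p])` satisfies
the local Selmer condition of `E′` at `v` iff `θ_* c` satisfies that of `E`.  Both conditions are
"unramified at `𝔓₀`" (good side: Gross 1991 (7.1), tree `selmerLocalKer_eq_unramifiedKer`; non-split
side: `selmerLocalKer_eq_unramifiedKer_of_nonsplit`, via `E(K_v)[p^∞] ⊆` the divisible part of
`E(K_v^nr)[p^∞]` — the Néron-component road, not the printed Tate-parametrisation road), and
unramifiedness passes through `θ` (`mem_unramifiedKer_iff_h1Equiv_mem`).  As printed (p. 106):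
"Let `E` and `F` be `ℓ`-congruent elliptic curves over `K`. Suppose that `E` has non-split
multiplicative reduction and `F` has good reduction. If `p = ℓ` then further suppose that
`e(K/ℚ_p) < p − 1`. Then `E(K)/ℓE(K)` and `F(K)/ℓF(K)` have the same images (via the Kummer exact
sequence) in `H¹(K, E[ℓ]) ≅ H¹(K, F[ℓ])`."  PRINTED PROOF: Tate parametrisation of the non-split
curve over the unramified quadratic extension + Lemmas 4.1/4.3; PROVED HERE (case `v ∤ ℓ` only) by
a different road — `c_v ∈ {1, 2}` and the `p`-divisibility of `E₀(K̄_v)[p^∞]` (Kodaira–Néron /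
Tate's algorithm Step 2), no Tate curve, no named fact.  The printed `v ∣ p`, `e(K_v/ℚ_p) < p − 1`
case is NOT covered.
[cite: Fisher2016Visualizing7, Thm. 4.4 (p. 106)] [cite: GrossLMS1991, §7 (7.1)] [cite: MilneADT2006, Ch. I Prop. 3.8] -/
theorem selmerLocalKer_iff_h1Equiv_of_nonsplit_good_of_not_mem (hp2 : p ≠ 2)
    (θ : geomTorsion W' (p : ℤ) ≃+ geomTorsion W (p : ℤ))
    (hθ : ∀ (σ : absoluteGaloisGroup K) (P : geomTorsion W' (p : ℤ)), θ (σ • P) = σ • θ P)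
    (v : HeightOneSpectrum (𝓞 K)) (hv : (p : 𝓞 K) ∉ v.asIdeal)
    (hkind : (W.HasMultiplicativeReductionAt v ∧ ¬ W.HasSplitMultiplicativeReductionAt v ∧
          W'.HasGoodReductionAt v) ∨
        (W.HasGoodReductionAt v ∧ W'.HasMultiplicativeReductionAt v ∧
          ¬ W'.HasSplitMultiplicativeReductionAt v))
    (c : galH1Torsion W' (p : ℤ)) :
    c ∈ selmerLocalKer W' (v.adicCompletion K) (p : ℤ) ↔
      h1Equiv θ hθ c ∈ selmerLocalKer W (v.adicCompletion K) (p : ℤ) := by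
  have hn : ((p : ℤ) : 𝓞 K) ∉ v.asIdeal := by rwa [Int.cast_natCast]
  have h𝔓₀ := adicCompletionPrime_mem_primesAbove K v
  rcases hkind with ⟨hW, hWns, hW'⟩ | ⟨hW, hW', hW'ns⟩
  · rw [W'.selmerLocalKer_eq_unramifiedKer hW' hn h𝔓₀,
      selmerLocalKer_eq_unramifiedKer_of_nonsplit W p hv hp2 hW hWns]
    exact mem_unramifiedKer_iff_h1Equiv_mem W W' θ hθ _ c
  · rw [W.selmerLocalKer_eq_unramifiedKer hW hn h𝔓₀,
      selmerLocalKer_eq_unramifiedKer_of_nonsplit W' p hv hp2 hW' hW'ns]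
    exact mem_unramifiedKer_iff_h1Equiv_mem W W' θ hθ _ c

/-- **Kind (iv′) without Tate uniformisation**: at `v ∤ p` (`p` odd) where `E` is NON-SPLIT
multiplicative and `E′` GOOD, `θ_* 𝓢_v(E′) ≤ 𝓢_v(E)` — the statement of the cell's
`NonsplitKummer.h1Equiv_mem_selmerLocalKer_of_nonsplit_of_hasGoodReductionAt` (seat p04) with the
named fact `hU2` REMOVED and non-splitness in Mathlib's form. [cite: Fisher2016Visualizing7, Thm. 4.4 (p. 106)]
[cite: CremonaMazur2000, §3] -/
theorem h1Equiv_mem_selmerLocalKer_of_not_split_of_good (hp2 : p ≠ 2)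
    (θ : geomTorsion W' (p : ℤ) ≃+ geomTorsion W (p : ℤ))
    (hθ : ∀ (σ : absoluteGaloisGroup K) (P : geomTorsion W' (p : ℤ)), θ (σ • P) = σ • θ P)
    {v : HeightOneSpectrum (𝓞 K)} (hv : (p : 𝓞 K) ∉ v.asIdeal)
    (hW : W.HasMultiplicativeReductionAt v) (hWns : ¬ W.HasSplitMultiplicativeReductionAt v)
    (hW' : W'.HasGoodReductionAt v)
    {c : galH1Torsion W' (p : ℤ)} (hc : c ∈ selmerLocalKer W' (v.adicCompletion K) (p : ℤ)) :
    h1Equiv θ hθ c ∈ selmerLocalKer W (v.adicCompletion K) (p : ℤ) :=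
  (selmerLocalKer_iff_h1Equiv_of_nonsplit_good_of_not_mem W W' hp2 θ hθ v hv
    (Or.inl ⟨hW, hWns, hW'⟩) c).mp hc

/-- **Kind (vi) without Tate uniformisation**: at `v ∤ p` (`p` odd) where `E` is GOOD and `E′`
NON-SPLIT multiplicative, `θ_* 𝓢_v(E′) ≤ 𝓢_v(E)` — the statement of the cell's
`NonsplitKummer.h1Equiv_mem_selmerLocalKer_of_hasGoodReductionAt_of_nonsplit` (seat p04) with `hU2`
REMOVED. [cite: Fisher2016Visualizing7, Thm. 4.4 (p. 106)] [cite: CremonaMazur2000, §3] -/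
theorem h1Equiv_mem_selmerLocalKer_of_good_of_not_split (hp2 : p ≠ 2)
    (θ : geomTorsion W' (p : ℤ) ≃+ geomTorsion W (p : ℤ))
    (hθ : ∀ (σ : absoluteGaloisGroup K) (P : geomTorsion W' (p : ℤ)), θ (σ • P) = σ • θ P)
    {v : HeightOneSpectrum (𝓞 K)} (hv : (p : 𝓞 K) ∉ v.asIdeal)
    (hW : W.HasGoodReductionAt v) (hW' : W'.HasMultiplicativeReductionAt v)
    (hW'ns : ¬ W'.HasSplitMultiplicativeReductionAt v)
    {c : galH1Torsion W' (p : ℤ)} (hc : c ∈ selmerLocalKer W' (v.adicCompletion K) (p : ℤ)) :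
    h1Equiv θ hθ c ∈ selmerLocalKer W (v.adicCompletion K) (p : ℤ) :=
  (selmerLocalKer_iff_h1Equiv_of_nonsplit_good_of_not_mem W W' hp2 θ hθ v hv
    (Or.inr ⟨hW, hW', hW'ns⟩) c).mp hc

/-- **`ι_v(θ) = 1` at a kind-(iv′)/(vi) place `v ∤ p`, `p` odd** — the comparison index of
`CongruenceVisibilityComparison.lean` is `1` (`relIndex_map_selmerLocalKer_eq_one_iff`); such a
place is FREE in the refined visibility count `exists_sha_ne_zero_of_congr_of_le_off`, with no named
fact. [cite: CremonaMazur2000, §3] [cite: Fisher2016Visualizing7, Thm. 4.4 (p. 106)] -/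
theorem relIndex_map_selmerLocalKer_eq_one_of_nonsplit_good_of_not_mem (hp2 : p ≠ 2)
    (θ : geomTorsion W' (p : ℤ) ≃+ geomTorsion W (p : ℤ))
    (hθ : ∀ (σ : absoluteGaloisGroup K) (P : geomTorsion W' (p : ℤ)), θ (σ • P) = σ • θ P)
    {v : HeightOneSpectrum (𝓞 K)} (hv : (p : 𝓞 K) ∉ v.asIdeal)
    (hkind : (W.HasMultiplicativeReductionAt v ∧ ¬ W.HasSplitMultiplicativeReductionAt v ∧
          W'.HasGoodReductionAt v) ∨
        (W.HasGoodReductionAt v ∧ W'.HasMultiplicativeReductionAt v ∧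
          ¬ W'.HasSplitMultiplicativeReductionAt v)) :
    (selmerLocalKer W (v.adicCompletion K) (p : ℤ)).relIndex
        ((selmerLocalKer W' (v.adicCompletion K) (p : ℤ)).map (h1Equiv θ hθ).toAddMonoidHom) = 1 :=
  (relIndex_map_selmerLocalKer_eq_one_iff W W' θ hθ).mpr fun c hc ↦
    (selmerLocalKer_iff_h1Equiv_of_nonsplit_good_of_not_mem W W' hp2 θ hθ v hv hkind c).mp hc

/-- **The `v ∤ p` half of the registered fact `Fisher2016.thm44_selmerLocalKer_iff_of_nonsplit_good`
(A46), in that fact's binder shape** with the ramification disjunct `(p ∉ v) ∨ e(v|p) < p − 1`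
specialised to its first member — so that consumers meeting kind-(iv) places only at `v ≠ p` (e.g.
`W` good supersingular AT `p`) can take this theorem in place of the hypothesis `hF44`.  The `v ∣ p`
disjunct remains the content of A46. [cite: Fisher2016Visualizing7, Thm. 4.4 (p. 106)] -/
theorem thm44_selmerLocalKer_iff_of_nonsplit_good_of_not_mem :
    ∀ {K : Type} [Field K] [NumberField K] (W W' : WeierstrassCurve K) [W.IsElliptic]
      [W'.IsElliptic] (p : ℕ) [Fact p.Prime], p ≠ 2 →
      ∀ (θ : geomTorsion W' (p : ℤ) ≃+ geomTorsion W (p : ℤ))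
        (hθ : ∀ (σ : absoluteGaloisGroup K) (P : geomTorsion W' (p : ℤ)), θ (σ • P) = σ • θ P)
        (v : HeightOneSpectrum (𝓞 K)),
        (p : 𝓞 K) ∉ v.asIdeal →
        ((W.HasMultiplicativeReductionAt v ∧ ¬ W.HasSplitMultiplicativeReductionAt v ∧
            W'.HasGoodReductionAt v) ∨
          (W.HasGoodReductionAt v ∧ W'.HasMultiplicativeReductionAt v ∧
            ¬ W'.HasSplitMultiplicativeReductionAt v)) →
        ∀ c : galH1Torsion W' (p : ℤ),
          c ∈ selmerLocalKer W' (v.adicCompletion K) (p : ℤ) ↔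
            h1Equiv θ hθ c ∈ selmerLocalKer W (v.adicCompletion K) (p : ℤ) :=
  fun W W' _ _ _ _ hp2 θ hθ v hv hkind c ↦
    selmerLocalKer_iff_h1Equiv_of_nonsplit_good_of_not_mem W W' hp2 θ hθ v hv hkind c

end Fisher

end Summit.BirchSwinnertonDyer.Rank1Residual.GaloisImage.InertiaDivisible

end
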